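import Summits.ABC.IUTFork.Charitable.Thm311D2IsoRungGlue
import Summits.ABC.IUTFork.Cor312PilotKummerSplitWitness
import HarnessLib

/-!
# [IUTchIII] Cor. 3.12 — branch D, team D2: rung (v) KIT — the summand flip `flipLast` of P♮₁'s split packets, an isometry outside ⟨(Ind1)∪(Ind2)⟩

Record file (D-0012; abc-iut cell, branch D, rung LADDER-ABC:A2.D; census row (R1b) of `HOME/plan/D2/CHARITY-D2.md` §10, item (v), KIT
half; seat abc-iut-D2-prv gen 2 — contingency build sanctioned by ANCHOR RULING #3, abc-iut-D2-typ g5, STATUS 2026-08-26T10:28:06Z; the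
separating instance itself is `Charitable/Thm311D2IsoSeparation.lean`). TAKES NO SIDE on [IUTchIII] Cor. 3.12 or on any author. MODEL
DATA over abc-iut-w5-d230's SPLIT model P♮₁ (`Cor312PilotKummerSplit*`: two valuations over one place, packets `(ℚ²)^{⊗(j+1)}` with
coordinates `coord c`, hull-sets the boxes `box D`, log-volume `−1 − #deepSet`, everything admissible) + kernel facts; NO `Prop` fact.
* §1 `flipLast` — the packet-automorphism family swapping the two SUMMANDS of the LAST tensor factor: `coord c (flipLast·x) =
  coord (flipIdx c) x` (`coord_flipLast`, last bit negated); it carries `box D` onto `box (flipFin D)` (`image_box_flipLast`), flips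
  deep sets (`deepSet_image_flipLast`) and preserves the log-volume of EVERY region (`splitVol_image_flipLast`) — an ISOMETRY in the
  sense of (R1b), `IsoAdmAt` at every column (`flipLast_isoAdmAt`); it is not a capsule permutation.
* §2 the flipped Θ-point generates the box `box (DFlipped j)` deep exactly on `{c | c(j) = true}` (`pointBox_flipLast_thetaPt`),
  `DFlipped j = flipFin (DTheta j)`.
Source of the nouns: S. Mochizuki, *Inter-universal Teichmüller theory III* (May 2020) = `paper:url-4b091feeb646`, Thm. 3.11 (i)
(Ind1)/(Ind2) p. 154. Interface-level toy; typed ≠ proved; locates / conditionally verifies; no abc claim. [claim: Mochizuki2012, status: disputed]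
-/

noncomputable section

open Set

namespace Summit.ABC.IUTFork.Charitable.D2

open Thm311 Cor312 Cor312Vol Cor312Vol.SplitWitness Literature.IUT.LogThetaLattice

/-! ## 1. The summand flip in the last tensor factor -/

/-- The involution of the fibre over the one rational place exchanging the two valuations. [folklore] -/
def fibFlip (vQ : splitIndex.VQ) : splitIndex.Fibre vQ ≃ splitIndex.Fibre vQ where
  toFun v := ⟨!v.1, v.2⟩
  invFun v := ⟨!v.1, v.2⟩
  left_inv v := Subtype.ext (Bool.not_not v.1)
  right_inv v := Subtype.ext (Bool.not_not v.1)

/-- `fibFlip` exchanges the two named points of the fibre. [folklore] -/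
theorem fibFlip_fib (vQ : splitIndex.VQ) (b : Bool) : fibFlip vQ (fib vQ b) = fib vQ (!b) := rfl

/-- The swap of the two summands of the 1-packet `⊕_{v ∣ v_ℚ} ℚ = (Fibre → ℚ)`. [folklore] -/
def swapSummands (vQ : splitIndex.VQ) : splitShells.Packet1 vQ ≃ₗ[ℚ] splitShells.Packet1 vQ :=
  LinearEquiv.funCongrLeft ℚ ℚ (fibFlip vQ)

/-- `swapSummands f v = f (v flipped)`. [folklore] -/
theorem swapSummands_apply (vQ : splitIndex.VQ) (f : splitShells.Packet1 vQ) (v : splitIndex.Fibre vQ) :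
    swapSummands vQ f v = f (fibFlip vQ v) := rfl

/-- **`flipLast`** — the packet-automorphism family acting on `(ℚ²)^{⊗(j+1)}` by the summand swap in the LAST tensor factor and the
identity in the others. A `ℚ`-linear automorphism of every packet; NOT induced by a capsule permutation or by (trivial) Ism. [folklore] -/
def flipLast : splitShells.PacketAut := fun j vQ =>
  splitShells.factorwise j vQ fun i => if i = Fin.last _ then swapSummands vQ else LinearEquiv.refl ℚ _

/-- The coordinate index with its last bit negated. [folklore] -/
def flipIdx {j : splitIndex.Label} (c : splitIndex.Caps j → Bool) : splitIndex.Caps j → Bool :=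
  Function.update c (Fin.last _) (!c (Fin.last _))

/-- `flipIdx` at the last index. [folklore] -/
theorem flipIdx_last {j : splitIndex.Label} (c : splitIndex.Caps j → Bool) : flipIdx c (Fin.last _) = !c (Fin.last _) := by
  simp [flipIdx]

/-- `flipIdx` elsewhere. [folklore] -/
theorem flipIdx_of_ne {j : splitIndex.Label} (c : splitIndex.Caps j → Bool) {i : splitIndex.Caps j} (h : i ≠ Fin.last _) :
    flipIdx c i = c i := by
  simp [flipIdx, h]

/-- `flipIdx` is an involution. [folklore] -/
theorem flipIdx_flipIdx {j : splitIndex.Label} (c : splitIndex.Caps j → Bool) : flipIdx (flipIdx c) = c := by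
  funext i
  by_cases h : i = Fin.last _
  · subst h; rw [flipIdx_last, flipIdx_last, Bool.not_not]
  · rw [flipIdx_of_ne _ h, flipIdx_of_ne _ h]

/-- **`flipLast` acts on the coordinates by `flipIdx`**: `coord c (flipLast·x) = coord (flipIdx c) x`. [folklore] -/
theorem coord_flipLast (j : splitIndex.Label) (vQ : splitIndex.VQ) (c : splitIndex.Caps j → Bool) (x : splitShells.Packet j vQ) :
    coord j vQ c (flipLast j vQ x) = coord j vQ (flipIdx c) x := by
  have h : (coord j vQ c).comp (flipLast j vQ).toLinearMap = coord j vQ (flipIdx c) := by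
    apply PiTensorProduct.ext
    ext y
    simp only [LinearMap.compMultilinearMap_apply]
    show coord j vQ c (flipLast j vQ (PiTensorProduct.tprod ℚ y)) = coord j vQ (flipIdx c) (PiTensorProduct.tprod ℚ y)
    have hf : flipLast j vQ (PiTensorProduct.tprod ℚ y) =
        PiTensorProduct.tprod ℚ fun i => (if i = Fin.last _ then swapSummands vQ else LinearEquiv.refl ℚ _) (y i) := by
      unfold flipLast LogShells.factorwise
      exact PiTensorProduct.congr_tprod _ _
    rw [hf, coord_tprod, coord_tprod]
    refine Finset.prod_congr rfl fun i _ => ?_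
    by_cases hi : i = Fin.last _
    · subst hi; rw [if_pos rfl, swapSummands_apply, fibFlip_fib, flipIdx_last]
    · rw [if_neg hi, flipIdx_of_ne c hi]; rfl
  exact congrArg (fun f : splitShells.Packet j vQ →ₗ[ℚ] ℚ => f x) h

/-- … and so does its inverse. [folklore] -/
theorem coord_flipLast_symm (j : splitIndex.Label) (vQ : splitIndex.VQ) (c : splitIndex.Caps j → Bool) (y : splitShells.Packet j vQ) :
    coord j vQ c ((flipLast j vQ).symm y) = coord j vQ (flipIdx c) y := by
  conv_rhs => rw [← (flipLast j vQ).apply_symm_apply y]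
  rw [coord_flipLast, flipIdx_flipIdx]

/-- The flipped set of deep coordinates. [folklore] -/
def flipFin {j : splitIndex.Label} (D : Finset (splitIndex.Caps j → Bool)) : Finset (splitIndex.Caps j → Bool) := D.image flipIdx

/-- Membership in the flipped set. [folklore] -/
theorem mem_flipFin_iff {j : splitIndex.Label} (D : Finset (splitIndex.Caps j → Bool)) (c : splitIndex.Caps j → Bool) :
    c ∈ flipFin D ↔ flipIdx c ∈ D := by
  unfold flipFin
  rw [Finset.mem_image]
  constructor
  · rintro ⟨c', hc', rfl⟩; rwa [flipIdx_flipIdx]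
  · intro h; exact ⟨flipIdx c, h, flipIdx_flipIdx c⟩

/-- The flipped set has the same cardinality. [folklore] -/
theorem card_flipFin {j : splitIndex.Label} (D : Finset (splitIndex.Caps j → Bool)) : (flipFin D).card = D.card :=
  Finset.card_image_of_injective _ fun c c' (h : flipIdx c = flipIdx c') => by
    rw [← flipIdx_flipIdx c, h, flipIdx_flipIdx]

/-- **`flipLast` carries `boxLE b D` onto `boxLE b (flipFin D)`** — boxes go to boxes, deep sets are flipped. [folklore] -/
theorem image_boxLE_flipLast (j : splitIndex.Label) (vQ : splitIndex.VQ) (b : ℚ) (D : Finset (splitIndex.Caps j → Bool)) :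
    flipLast j vQ '' boxLE b D = boxLE b (flipFin D) := by
  ext y
  constructor
  · rintro ⟨x, hx, rfl⟩
    refine ⟨fun c => ?_, fun c hc => ?_⟩
    · rw [coord_flipLast]; exact hx.1 _
    · rw [coord_flipLast]; exact hx.2 _ ((mem_flipFin_iff D c).1 hc)
  · rintro ⟨h8, hD⟩
    refine ⟨(flipLast j vQ).symm y, ⟨fun c => ?_, fun c hc => ?_⟩, LinearEquiv.apply_symm_apply _ _⟩
    · rw [coord_flipLast_symm]; exact h8 _
    · rw [coord_flipLast_symm]
      apply hD
      rw [mem_flipFin_iff, flipIdx_flipIdx]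
      exact hc

/-- `flipLast` carries the hull-set `box D` onto `box (flipFin D)`. [folklore] -/
theorem image_box_flipLast (j : splitIndex.Label) (vQ : splitIndex.VQ) (D : Finset (splitIndex.Caps j → Bool)) :
    flipLast j vQ '' box D = box (flipFin D) :=
  image_boxLE_flipLast j vQ 1 D

/-- The inverse carries boxes the same way (the flip of deep sets is an involution). [folklore] -/
theorem symm_image_box_flipLast (j : splitIndex.Label) (vQ : splitIndex.VQ) (D : Finset (splitIndex.Caps j → Bool)) :
    (flipLast j vQ).symm '' box D = box (flipFin D) := by
  ext x
  constructor
  · rintro ⟨y, hy, rfl⟩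
    refine ⟨fun c => ?_, fun c hc => ?_⟩
    · rw [coord_flipLast_symm]; exact hy.1 _
    · rw [coord_flipLast_symm]; exact hy.2 _ ((mem_flipFin_iff D c).1 hc)
  · rintro ⟨h8, hD⟩
    refine ⟨flipLast j vQ x, ⟨fun c => ?_, fun c hc => ?_⟩, LinearEquiv.symm_apply_apply _ _⟩
    · rw [coord_flipLast]; exact h8 _
    · rw [coord_flipLast]
      apply hD
      rw [mem_flipFin_iff, flipIdx_flipIdx]
      exact hc

/-- `flipLast '' U ⊆ box D ↔ U ⊆ box (flipFin D)`. [folklore] -/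
theorem flipLast_image_subset_box_iff (j : splitIndex.Label) (vQ : splitIndex.VQ) (U : Set (splitShells.Packet j vQ))
    (D : Finset (splitIndex.Caps j → Bool)) : flipLast j vQ '' U ⊆ box D ↔ U ⊆ box (flipFin D) := by
  rw [Set.image_subset_iff, ← LinearEquiv.image_symm_eq_preimage, symm_image_box_flipLast]

/-- **Deep sets are flipped**: `deepSet (flipLast·U) = flipFin (deepSet U)`. [folklore] -/
theorem deepSet_image_flipLast (j : splitIndex.Label) (vQ : splitIndex.VQ) (U : Set (splitShells.Packet j vQ)) :
    deepSet (flipLast j vQ '' U) = flipFin (deepSet U) := by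
  ext c
  rw [mem_deepSet_iff, mem_flipFin_iff, mem_deepSet_iff, flipLast_image_subset_box_iff]
  have : flipFin ({c} : Finset (splitIndex.Caps j → Bool)) = {flipIdx c} := by
    unfold flipFin; rw [Finset.image_singleton]
  rw [this]

/-- **`flipLast` PRESERVES THE LOG-VOLUME OF EVERY REGION** of P♮₁ (`−1 − #deepSet`, resp. `0` off the shallow box) — it is an
ISOMETRY of the column data, though not an indeterminacy. [folklore] -/
theorem splitVol_image_flipLast (j : splitIndex.Label) (vQ : splitIndex.VQ) (U : Set (splitShells.Packet j vQ)) :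
    splitVol j vQ (flipLast j vQ '' U) = splitVol j vQ U := by
  have h0 : flipLast j vQ '' U ⊆ box ∅ ↔ U ⊆ box ∅ := by
    rw [flipLast_image_subset_box_iff]; unfold flipFin; rw [Finset.image_empty]
  unfold splitVol
  by_cases hU : U ⊆ box ∅
  · rw [if_pos (h0.2 hU), if_pos hU, deepSet_image_flipLast, card_flipFin]
  · rw [if_neg (fun h => hU (h0.1 h)), if_neg hU]

/-- **`flipLast` is a column-`n` isometry in the sense of (R1b)** (abc-iut-D2-typ's `IsoAdmAt`, every column: P♮₁'s data are
column-constant and everything is admissible). [folklore] -/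
theorem flipLast_isoAdmAt (n : ℤ) : IsoAdmAt splitFull.toLatticeSituation n flipLast := fun j vQ B =>
  ⟨Iff.rfl, fun _ => splitVol_image_flipLast j vQ B⟩

/-! ## 2. The flipped Θ-point and its box -/

/-- The deep set of the flipped Θ-box at label `j`: `{c | c(j) = true}`. [folklore] -/
def DFlipped (j : splitIndex.Label) : Finset (splitIndex.Caps j → Bool) := Finset.univ.filter fun c => c (Fin.last _) = true

/-- `DFlipped j` is the flip of `DTheta j`. [folklore] -/
theorem DFlipped_eq_flipFin (j : splitIndex.Label) : DFlipped j = flipFin (DTheta j) := by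
  ext c
  rw [mem_flipFin_iff]
  unfold DFlipped DTheta
  simp only [Finset.mem_filter, Finset.mem_univ, true_and, flipIdx_last]
  cases c (Fin.last _) <;> simp

/-- The coordinates of the flipped Θ-point: `2^j` where `c(j) = false`, `0` where `c(j) = true`. [folklore] -/
theorem coord_flipLast_thetaPt (j : splitIndex.Label) (vQ : splitIndex.VQ) (c : splitIndex.Caps j → Bool) :
    coord j vQ c (flipLast j vQ (thetaPt j vQ)) = 2 ^ (j : ℕ) * (if c (Fin.last _) = false then 1 else 0) := by
  rw [coord_flipLast, coord_thetaPt, flipIdx_last]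
  cases c (Fin.last _) <;> simp

/-- **The flipped Θ-point generates the flipped box** `box (DFlipped j)` (labels `j ≥ 1`). [folklore] -/
theorem pointBox_flipLast_thetaPt {j : splitIndex.Label} (hj : j ≠ 0) (vQ : splitIndex.VQ) :
    pointBox (flipLast j vQ (thetaPt j vQ)) = box (DFlipped j) := by
  classical
  unfold pointBox DFlipped
  congr 1
  ext c
  simp only [Finset.mem_filter, Finset.mem_univ, true_and]
  rw [coord_flipLast, abs_coord_thetaPt_le_one_iff hj, flipIdx_last]
  cases c (Fin.last _) <;> simp

end Summit.ABC.IUTFork.Charitable.D2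

end
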